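import Summits.AtomisticToContinuum.Crystallization.Theorems.FrustratedLawDichotomyAperiodicGapRecordJunctionCore
import Summits.AtomisticToContinuum.Crystallization.Theorems.FrustratedLawDichotomyStrainedPatchShellSplit
import HarnessLib

/-!
# FrustratedLawDichotomy · crux `AperiodicFrustratedLawGap` (stmt-AtomisticToContinuum-27623) — RECORD JUNCTION, SHELL-SPLIT FORM
# (decomp-a2c, prover hand 2, generation 34; structural share; landed THROUGH the [CORE-FAR] junction `…RecordJunctionCore`, one term per theorem)

lens-5 g80's node «ShellSplit» (`…StrainedPatchShellSplit`; the OCX8 «format delta» of critic rows 1284/1285/1287 (2)/1289): for any host-decidable EXTERIOR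
SELECTOR `S : ShellSel` the host exterior-annulus constant `shellConst τ S` moves from the host side of the far column to the cluster side — (HFAR-S)
`HostFarTabS 𝓘 τ r S Xh` (per host, same admissible reading as (HFAR)) and (XTAIL-S) `ShellTail 𝓘 τ S Xe` (cluster-quantified; never harder than (XTAIL),
`shellTail_of_extTail_add`; the record of `…TailPacking` is the EMPTY selector).  Its records conclude the SAME [CORE-FAR]
`CoreOffTubeFloor (63/10) (63/10) (24/5) (1/100) 0`: `coreOff_of_envelope_shellTabs` (uniform host top/steps), `coreOff_of_envelope_shellTabs_pairTabsG` (graded table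
currency) and `coreOff_record_of_gradeTol_shellTabs` (the census cell).  This DEF-FREE module threads them to the crux BY NAME:

* §1 ★★★ `aperiodicFrustratedLawGap_of_entryTreesU_of_envelope_shellTabs` — uniform currency, every `𝓘`, `τ ≥ 0`, selector `S`, column data; periodic sibling (27624);
* §2 ★★★ `aperiodicFrustratedLawGap_of_entryTreesU_of_envelope_shellTabs_pairTabsG` — graded table currency (BC-G ∧ HFAR-S ∧ XTAIL-S ∧ START-G ∧ STAGE-Gᵢ ∧ CERT-G),
  every `𝓘`, `τ ≥ 0`, `T`, `S`, `P`, `n`; periodic sibling;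
* §3 ★★ `aperiodicFrustratedLawGap_of_entryTreesU_of_gradeTol_shellTabs` — the census cell `τ = 1/100`, `T = gradeTol R_g τ_in (1/100)`, selector `S`
  (at `S = annulusSel 7` with the SHELL-MATCH certificate of generation 81 this is the typed home of an OCX8-type PASS);
* §4 sanity: the EMPTY selector recovers the graded-stage junction's data (`…_via_shell`), an `example`.

One-line compositions; 0 sorry; no definitions; standard axioms.  `--supports stmt-AtomisticToContinuum-27623`.  [folklore instantiation]
-/

noncomputable section

namespace Summit.AtomisticToContinuum.Crystallization.Theorems.FrustratedLawDichotomyAperiodicGapRecordJunctionShell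

open Summit.AtomisticToContinuum.Crystallization.Theorems.ChargedEnergyGapNegative (eStar E3)
open Summit.AtomisticToContinuum.Crystallization.Theorems.FrustratedLawDichotomyRangeCut
open Summit.AtomisticToContinuum.Crystallization.Theorems.FrustratedLawDichotomySchurCut
open Summit.AtomisticToContinuum.Crystallization.Theorems.FrustratedLawDichotomyMotifLemmas (GoodAtScale)
open Summit.AtomisticToContinuum.Crystallization.Theorems.FrustratedLawDichotomyExemptLocOpt (LocOptFails)
open Summit.AtomisticToContinuum.Crystallization.Theorems.FrustratedLawDichotomyExemptSplit (SchurElasticPricingX)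
open Summit.AtomisticToContinuum.Crystallization.Theorems.FrustratedLawDichotomyExemptAbsorptionRecord
open Summit.AtomisticToContinuum.Crystallization.Theorems.FrustratedLawDichotomyCollarCensus
open Summit.AtomisticToContinuum.Crystallization.Theorems.FrustratedLawDichotomyCollarCensusKappa
open Summit.AtomisticToContinuum.Crystallization.Theorems.FrustratedLawDichotomyStrainedPatchHomSplit
open Summit.AtomisticToContinuum.Crystallization.Theorems.FrustratedLawDichotomyStrainedPatchCleanCollar (TailPenalty AnnularDefectFloor DefectiveCollarFloor)
open Summit.AtomisticToContinuum.Crystallization.Theorems.FrustratedLawDichotomyStrainedPatchPhaseCut (AnnularPhaseFloor PolyTextureFloor)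
open Summit.AtomisticToContinuum.Crystallization.Theorems.FrustratedLawDichotomyStrainedPatchCoreTube (CoreOffTubeFloor)
open Summit.AtomisticToContinuum.Crystallization.Theorems.FrustratedLawDichotomyStrainedPatchCoreTubeRecord (CoreCoreRelief)
open Summit.AtomisticToContinuum.Crystallization.Theorems.FrustratedLawDichotomyStrainedPatchHostCells (FamilyCover)
open Summit.AtomisticToContinuum.Crystallization.Theorems.FrustratedLawDichotomyStrainedPatchHomCertTree (CertTree treeOK)
open Summit.AtomisticToContinuum.Crystallization.Theorems.FrustratedLawDichotomyStrainedPatchHomEntryGram (rootC rootW)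
open Summit.AtomisticToContinuum.Crystallization.Theorems.FrustratedLawDichotomyStrainedPatchHomEntryGramHcp (rootCH rootWH)
open Summit.AtomisticToContinuum.Crystallization.Theorems.FrustratedLawDichotomyStrainedPatchHomEntryTable (muRec)
open Summit.AtomisticToContinuum.Crystallization.Theorems.FrustratedLawDichotomyStrainedPatchHomEntryTableP (entryLeafOK6RBKP)
open Summit.AtomisticToContinuum.Crystallization.Theorems.FrustratedLawDichotomyStrainedPatchHomEntryLeafHT (HTCert entryLeafOKHT4UQDCRX)
open Summit.AtomisticToContinuum.Crystallization.Theorems.FrustratedLawDichotomyStrainedPatchQuantSlaving (ChartFam HessTab ForceTab SlackTab hessBlk0 force0)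
open Summit.AtomisticToContinuum.Crystallization.Theorems.FrustratedLawDichotomyStrainedPatchSVCharge (SlackCert)
open Summit.AtomisticToContinuum.Crystallization.Theorems.FrustratedLawDichotomyStrainedPatchTaylorCharge (HostSep cubicTail)
open Summit.AtomisticToContinuum.Crystallization.Theorems.FrustratedLawDichotomyStrainedPatchHostStep (HostTop HostStep)
open Summit.AtomisticToContinuum.Crystallization.Theorems.FrustratedLawDichotomyStrainedPatchBondCalculus (bondD3)
open Summit.AtomisticToContinuum.Crystallization.Theorems.FrustratedLawDichotomyStrainedPatchFarSplit (HostFarTab gammaMaj)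
open Summit.AtomisticToContinuum.Crystallization.Theorems.FrustratedLawDichotomyStrainedPatchTailPacking (TailCert)
open Summit.AtomisticToContinuum.Crystallization.Theorems.FrustratedLawDichotomyStrainedPatchRowPrice (addCol)
open Summit.AtomisticToContinuum.Crystallization.Theorems.FrustratedLawDichotomyStrainedPatchGradStep (PairMap PairAdm)
open Summit.AtomisticToContinuum.Crystallization.Theorems.FrustratedLawDichotomyStrainedPatchGradedTube (FamilyCoverG gradeTol)
open Summit.AtomisticToContinuum.Crystallization.Theorems.FrustratedLawDichotomyStrainedPatchGradedDescent (SlackCertG)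
open Summit.AtomisticToContinuum.Crystallization.Theorems.FrustratedLawDichotomyStrainedPatchGradedStage (DiffEvalTabG boxTabG StageCertG)
open Summit.AtomisticToContinuum.Crystallization.Theorems.FrustratedLawDichotomyStrainedPatchShellSplit (ShellSel emptySel HostFarTabS ShellTail
  coreOff_of_envelope_shellTabs coreOff_of_envelope_shellTabs_pairTabsG coreOff_record_of_gradeTol_shellTabs coreOff_record_of_gradeTol_pairTabs_via_shell)
open Summit.AtomisticToContinuum.Crystallization.Theorems.FrustratedLawDichotomyAperiodicGapRecordJunctionCore

/-! ## §1 ★★★ The crux BY NAME from the entry trees and the UNIFORM shell-split record -/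

/-- ★★★ **27623 FROM THE ENTRY TREES AND THE SHELL-SPLIT RECORD (uniform currency)** — the crux BY NAME from
`UP ∧ 0 ≤ D_X ∧ Eopt-raw ∧ (∃ fcc tree) ∧ (∃ hcp HT4UQDCRX tree) ∧ TailPenalty ∧ CoreCoreRelief ∧ FamilyCover 𝓘 (24/5) (1/100) (1/8) τ ∧ 2τ < s₀ ∧ HostSep ∧ r + 2τ ≤ 7 ∧
(HFAR-S) HostFarTabS 𝓘 τ r S Xh ∧ (XTAIL-S) ShellTail 𝓘 τ S Xe ∧ (Xh + Xe ≤ X) ∧ HostTop ∧ HostStep-table ∧ SlackCert … (k n) … X ∧ AnnularPhaseFloor ∧ PolyTextureFloor ∧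
AnnularDefectFloor ∧ DefectiveCollarFloor ∧ CC∪T₀ ∧ DD∪T₀`, every family `𝓘`, `τ ≥ 0`, selector `S`.  ONE TERM: `hC := …ShellSplit.coreOff_of_envelope_shellTabs …`.
[folklore instantiation] -/
theorem aperiodicFrustratedLawGap_of_entryTreesU_of_envelope_shellTabs {𝓘 : ChartFam} {τ s₀ r : ℝ} {S : ShellSel} {X Xh Xe : SlackTab}
    {εE CE DE DX : ℝ} (k : ℕ → ℝ) (n : ℕ) (hτ : 0 ≤ τ)
    (hε0 : 0 < εE) (hε1 : εE ≤ 1 / 10000) (hU : PeriodicEnergyCeiling (-(7175 / 10000))) (hDX : 0 ≤ DX)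
    (hE : SchurElasticPricingX (1 / 20) (1 / 8) w₄₅ ω₄ (3 / 400) (-(7175 / 10000)) (1 / 10000) CE DE DX (LocOptFails eStar εE (3 / 2) 1))
    (Pc : ((Fin 3 × Fin 3) ⊕ Fin 3 → ℤ) → ((Fin 3 × Fin 3) ⊕ Fin 3 → ℤ) → HTCert)
    (Qf : ((Fin 3 × Fin 3) ⊕ Fin 3 → ℤ) → ((Fin 3 × Fin 3) ⊕ Fin 3 → ℤ) → (Fin 4 → ℤ))
    (Tc : ((Fin 3 × Fin 3) ⊕ Fin 3 → ℤ) → ((Fin 3 × Fin 3) ⊕ Fin 3 → ℤ) → CertTree ((Fin 3 × Fin 3) ⊕ Fin 3))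
    (hFcc : ∃ t : CertTree (Fin 3 × Fin 3), treeOK (entryLeafOK6RBKP muRec) t rootC rootW = true)
    (hHcp : ∃ t : CertTree ((Fin 3 × Fin 3) ⊕ Fin 3), treeOK (entryLeafOKHT4UQDCRX muRec Pc Qf Tc) t rootCH rootWH = true)
    (hT : TailPenalty (24 / 5) (1 / 1000)) (hRl : CoreCoreRelief (63 / 10) (63 / 10) (24 / 5) (1 / 100) (3 / 5000))
    (hcov : FamilyCover 𝓘 (24 / 5) (1 / 100) (1 / 8) τ) (hτs : 2 * τ < s₀) (hsep : HostSep 𝓘 s₀) (hr7 : r + 2 * τ ≤ 7)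
    (hH : HostFarTabS 𝓘 τ r S Xh) (hSh : ShellTail 𝓘 τ S Xe)
    (hdom : ∀ (M₀ : ℕ) (z₀ : Fin M₀ → E3) (c₀ h : Fin M₀), Xh M₀ z₀ c₀ h + Xe M₀ z₀ c₀ h ≤ X M₀ z₀ c₀ h)
    (h0 : HostTop 𝓘 τ bondD3 (cubicTail fun s => gammaMaj (s - 2 * τ)) r (k 0 * sigmaOne))
    (hs : ∀ i : ℕ, i < n → HostStep 𝓘 τ sigmaOne bondD3 (cubicTail fun s => gammaMaj (s - 2 * τ)) r hessBlk0 force0 X (k i) (k (i + 1) * sigmaOne))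
    (hcert : SlackCert 𝓘 τ (k n) sigmaOne hessBlk0 force0 X)
    (hF : AnnularPhaseFloor (63 / 10) (24 / 5) (63 / 10) (1 / 1000)) (hP : PolyTextureFloor (63 / 10) (24 / 5) (1 / 1000))
    (hA : AnnularDefectFloor (24 / 5) (63 / 10)) (hD : DefectiveCollarFloor (24 / 5))
    (h2 : CrowdedCoreMotifPricingCapK (1 / 1000) (9 / 5) (133 / 10) (3 / 2) (effPot w₄₅ ω₄ (3 / 400)) (-(7175 / 10000) + 3 / 400)
      (Collar (9 / 2) fun N y j => (∃ s : ℝ, 0 ≤ s ∧ s ≤ 3 / 2 ∧ NonEquilibriumCore (-(7175 / 10000)) 0 7 s (1 / 10000) N y j) ∨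
        GoodAtScale (1 / 20) (3 / 2) y j))
    (h3 : DiluteDefectMotifPricingCapK (1 / 1000) (9 / 5) (133 / 10) (3 / 2) (effPot w₄₅ ω₄ (3 / 400)) (-(7175 / 10000) + 3 / 400)
      (Collar (9 / 2) fun N y j => (∃ s : ℝ, 0 ≤ s ∧ s ≤ 3 / 2 ∧ NonEquilibriumCore (-(7175 / 10000)) 0 7 s (1 / 10000) N y j) ∨
        GoodAtScale (1 / 20) (3 / 2) y j)) :
    Summit.AtomisticToContinuum.Crystallization.Theses.FrustratedLawDichotomy.AperiodicFrustratedLawGap :=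
  aperiodicFrustratedLawGap_of_entryTreesHTU_of_coreOff hε0 hε1 hU hDX hE Pc Qf Tc hFcc hHcp hT hRl
    (coreOff_of_envelope_shellTabs k n hτ hcov hτs hsep hr7 hH hSh hdom h0 hs hcert) hF hP hA hD h2 h3

/-- ★★ **Periodic sibling (27624)** of the uniform shell-split junction. [folklore instantiation] -/
theorem periodicFrustratedLawGap_of_entryTreesU_of_envelope_shellTabs {𝓘 : ChartFam} {τ s₀ r : ℝ} {S : ShellSel} {X Xh Xe : SlackTab}
    {εE CE DE DX : ℝ} (k : ℕ → ℝ) (n : ℕ) (hτ : 0 ≤ τ)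
    (hε0 : 0 < εE) (hε1 : εE ≤ 1 / 10000) (hU : PeriodicEnergyCeiling (-(7175 / 10000))) (hDX : 0 ≤ DX)
    (hE : SchurElasticPricingX (1 / 20) (1 / 8) w₄₅ ω₄ (3 / 400) (-(7175 / 10000)) (1 / 10000) CE DE DX (LocOptFails eStar εE (3 / 2) 1))
    (Pc : ((Fin 3 × Fin 3) ⊕ Fin 3 → ℤ) → ((Fin 3 × Fin 3) ⊕ Fin 3 → ℤ) → HTCert)
    (Qf : ((Fin 3 × Fin 3) ⊕ Fin 3 → ℤ) → ((Fin 3 × Fin 3) ⊕ Fin 3 → ℤ) → (Fin 4 → ℤ))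
    (Tc : ((Fin 3 × Fin 3) ⊕ Fin 3 → ℤ) → ((Fin 3 × Fin 3) ⊕ Fin 3 → ℤ) → CertTree ((Fin 3 × Fin 3) ⊕ Fin 3))
    (hFcc : ∃ t : CertTree (Fin 3 × Fin 3), treeOK (entryLeafOK6RBKP muRec) t rootC rootW = true)
    (hHcp : ∃ t : CertTree ((Fin 3 × Fin 3) ⊕ Fin 3), treeOK (entryLeafOKHT4UQDCRX muRec Pc Qf Tc) t rootCH rootWH = true)
    (hT : TailPenalty (24 / 5) (1 / 1000)) (hRl : CoreCoreRelief (63 / 10) (63 / 10) (24 / 5) (1 / 100) (3 / 5000))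
    (hcov : FamilyCover 𝓘 (24 / 5) (1 / 100) (1 / 8) τ) (hτs : 2 * τ < s₀) (hsep : HostSep 𝓘 s₀) (hr7 : r + 2 * τ ≤ 7)
    (hH : HostFarTabS 𝓘 τ r S Xh) (hSh : ShellTail 𝓘 τ S Xe)
    (hdom : ∀ (M₀ : ℕ) (z₀ : Fin M₀ → E3) (c₀ h : Fin M₀), Xh M₀ z₀ c₀ h + Xe M₀ z₀ c₀ h ≤ X M₀ z₀ c₀ h)
    (h0 : HostTop 𝓘 τ bondD3 (cubicTail fun s => gammaMaj (s - 2 * τ)) r (k 0 * sigmaOne))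
    (hs : ∀ i : ℕ, i < n → HostStep 𝓘 τ sigmaOne bondD3 (cubicTail fun s => gammaMaj (s - 2 * τ)) r hessBlk0 force0 X (k i) (k (i + 1) * sigmaOne))
    (hcert : SlackCert 𝓘 τ (k n) sigmaOne hessBlk0 force0 X)
    (hF : AnnularPhaseFloor (63 / 10) (24 / 5) (63 / 10) (1 / 1000)) (hP : PolyTextureFloor (63 / 10) (24 / 5) (1 / 1000))
    (hA : AnnularDefectFloor (24 / 5) (63 / 10)) (hD : DefectiveCollarFloor (24 / 5))
    (h2 : CrowdedCoreMotifPricingCapK (1 / 1000) (9 / 5) (133 / 10) (3 / 2) (effPot w₄₅ ω₄ (3 / 400)) (-(7175 / 10000) + 3 / 400)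
      (Collar (9 / 2) fun N y j => (∃ s : ℝ, 0 ≤ s ∧ s ≤ 3 / 2 ∧ NonEquilibriumCore (-(7175 / 10000)) 0 7 s (1 / 10000) N y j) ∨
        GoodAtScale (1 / 20) (3 / 2) y j))
    (h3 : DiluteDefectMotifPricingCapK (1 / 1000) (9 / 5) (133 / 10) (3 / 2) (effPot w₄₅ ω₄ (3 / 400)) (-(7175 / 10000) + 3 / 400)
      (Collar (9 / 2) fun N y j => (∃ s : ℝ, 0 ≤ s ∧ s ≤ 3 / 2 ∧ NonEquilibriumCore (-(7175 / 10000)) 0 7 s (1 / 10000) N y j) ∨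
        GoodAtScale (1 / 20) (3 / 2) y j)) :
    Summit.AtomisticToContinuum.Crystallization.Theses.FrustratedLawDichotomy.PeriodicFrustratedLawGap :=
  periodicFrustratedLawGap_of_entryTreesHTU_of_coreOff hε0 hε1 hU hDX hE Pc Qf Tc hFcc hHcp hT hRl
    (coreOff_of_envelope_shellTabs k n hτ hcov hτs hsep hr7 hH hSh hdom h0 hs hcert) hF hP hA hD h2 h3

/-! ## §2 ★★★ The crux BY NAME from the entry trees and the GRADED shell-split record (table currency) -/

/-- ★★★ **27623 FROM THE ENTRY TREES AND THE GRADED SHELL-SPLIT RECORD** — the crux BY NAME from the E-spine ∧ collar floors ∧ caps ∧ (BC-G)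
`FamilyCoverG 𝓘 (24/5) (1/100) (1/8) τ T` ∧ 2τ < s₀ ∧ HostSep ∧ r + 2τ ≤ 7 ∧ (HFAR-S) ∧ (XTAIL-S) ∧ (Xh + Xe ≤ X) ∧ PairAdm r Pm ∧ (START-G) DiffEvalTabG … (boxTabG T) (P 0) ∧
(STAGE-G)ᵢ StageCertG … ∧ (CERT-G) SlackCertG … 0 … (addCol X (P n))`, every `𝓘`, `τ ≥ 0`, `T`, `S`, `P`, `n`.  ONE TERM:
`hC := …ShellSplit.coreOff_of_envelope_shellTabs_pairTabsG …`. [folklore instantiation] -/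
theorem aperiodicFrustratedLawGap_of_entryTreesU_of_envelope_shellTabs_pairTabsG {𝓘 : ChartFam} {T : SlackTab} {τ s₀ r : ℝ} {S : ShellSel}
    {X Xh Xe : SlackTab} {Pm : PairMap} {εE CE DE DX : ℝ} (P : ℕ → SlackTab) (n : ℕ) (hτ : 0 ≤ τ)
    (hε0 : 0 < εE) (hε1 : εE ≤ 1 / 10000) (hU : PeriodicEnergyCeiling (-(7175 / 10000))) (hDX : 0 ≤ DX)
    (hE : SchurElasticPricingX (1 / 20) (1 / 8) w₄₅ ω₄ (3 / 400) (-(7175 / 10000)) (1 / 10000) CE DE DX (LocOptFails eStar εE (3 / 2) 1))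
    (Pc : ((Fin 3 × Fin 3) ⊕ Fin 3 → ℤ) → ((Fin 3 × Fin 3) ⊕ Fin 3 → ℤ) → HTCert)
    (Qf : ((Fin 3 × Fin 3) ⊕ Fin 3 → ℤ) → ((Fin 3 × Fin 3) ⊕ Fin 3 → ℤ) → (Fin 4 → ℤ))
    (Tc : ((Fin 3 × Fin 3) ⊕ Fin 3 → ℤ) → ((Fin 3 × Fin 3) ⊕ Fin 3 → ℤ) → CertTree ((Fin 3 × Fin 3) ⊕ Fin 3))
    (hFcc : ∃ t : CertTree (Fin 3 × Fin 3), treeOK (entryLeafOK6RBKP muRec) t rootC rootW = true)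
    (hHcp : ∃ t : CertTree ((Fin 3 × Fin 3) ⊕ Fin 3), treeOK (entryLeafOKHT4UQDCRX muRec Pc Qf Tc) t rootCH rootWH = true)
    (hT : TailPenalty (24 / 5) (1 / 1000)) (hRl : CoreCoreRelief (63 / 10) (63 / 10) (24 / 5) (1 / 100) (3 / 5000))
    (hcov : FamilyCoverG 𝓘 (24 / 5) (1 / 100) (1 / 8) τ T) (hτs : 2 * τ < s₀) (hsep : HostSep 𝓘 s₀) (hr7 : r + 2 * τ ≤ 7)
    (hH : HostFarTabS 𝓘 τ r S Xh) (hSh : ShellTail 𝓘 τ S Xe)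
    (hdom : ∀ (M₀ : ℕ) (z₀ : Fin M₀ → E3) (c₀ h : Fin M₀), Xh M₀ z₀ c₀ h + Xe M₀ z₀ c₀ h ≤ X M₀ z₀ c₀ h) (hPm : PairAdm r Pm)
    (h0 : DiffEvalTabG 𝓘 τ T bondD3 (cubicTail fun s => gammaMaj (s - 2 * τ)) r (boxTabG T) (P 0))
    (hs : ∀ i : ℕ, i < n → StageCertG 𝓘 τ T sigmaOne bondD3 (cubicTail fun s => gammaMaj (s - 2 * τ)) r hessBlk0 force0 Pm (addCol X (P i)) (P (i + 1)))
    (hcert : SlackCertG 𝓘 τ T 0 sigmaOne hessBlk0 force0 (addCol X (P n)))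
    (hF : AnnularPhaseFloor (63 / 10) (24 / 5) (63 / 10) (1 / 1000)) (hP : PolyTextureFloor (63 / 10) (24 / 5) (1 / 1000))
    (hA : AnnularDefectFloor (24 / 5) (63 / 10)) (hD : DefectiveCollarFloor (24 / 5))
    (h2 : CrowdedCoreMotifPricingCapK (1 / 1000) (9 / 5) (133 / 10) (3 / 2) (effPot w₄₅ ω₄ (3 / 400)) (-(7175 / 10000) + 3 / 400)
      (Collar (9 / 2) fun N y j => (∃ s : ℝ, 0 ≤ s ∧ s ≤ 3 / 2 ∧ NonEquilibriumCore (-(7175 / 10000)) 0 7 s (1 / 10000) N y j) ∨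
        GoodAtScale (1 / 20) (3 / 2) y j))
    (h3 : DiluteDefectMotifPricingCapK (1 / 1000) (9 / 5) (133 / 10) (3 / 2) (effPot w₄₅ ω₄ (3 / 400)) (-(7175 / 10000) + 3 / 400)
      (Collar (9 / 2) fun N y j => (∃ s : ℝ, 0 ≤ s ∧ s ≤ 3 / 2 ∧ NonEquilibriumCore (-(7175 / 10000)) 0 7 s (1 / 10000) N y j) ∨
        GoodAtScale (1 / 20) (3 / 2) y j)) :
    Summit.AtomisticToContinuum.Crystallization.Theses.FrustratedLawDichotomy.AperiodicFrustratedLawGap :=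
  aperiodicFrustratedLawGap_of_entryTreesHTU_of_coreOff hε0 hε1 hU hDX hE Pc Qf Tc hFcc hHcp hT hRl
    (coreOff_of_envelope_shellTabs_pairTabsG P n hτ hcov hτs hsep hr7 hH hSh hdom hPm h0 hs hcert) hF hP hA hD h2 h3

/-- ★★ **Periodic sibling (27624)** of the graded shell-split junction. [folklore instantiation] -/
theorem periodicFrustratedLawGap_of_entryTreesU_of_envelope_shellTabs_pairTabsG {𝓘 : ChartFam} {T : SlackTab} {τ s₀ r : ℝ} {S : ShellSel}
    {X Xh Xe : SlackTab} {Pm : PairMap} {εE CE DE DX : ℝ} (P : ℕ → SlackTab) (n : ℕ) (hτ : 0 ≤ τ)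
    (hε0 : 0 < εE) (hε1 : εE ≤ 1 / 10000) (hU : PeriodicEnergyCeiling (-(7175 / 10000))) (hDX : 0 ≤ DX)
    (hE : SchurElasticPricingX (1 / 20) (1 / 8) w₄₅ ω₄ (3 / 400) (-(7175 / 10000)) (1 / 10000) CE DE DX (LocOptFails eStar εE (3 / 2) 1))
    (Pc : ((Fin 3 × Fin 3) ⊕ Fin 3 → ℤ) → ((Fin 3 × Fin 3) ⊕ Fin 3 → ℤ) → HTCert)
    (Qf : ((Fin 3 × Fin 3) ⊕ Fin 3 → ℤ) → ((Fin 3 × Fin 3) ⊕ Fin 3 → ℤ) → (Fin 4 → ℤ))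
    (Tc : ((Fin 3 × Fin 3) ⊕ Fin 3 → ℤ) → ((Fin 3 × Fin 3) ⊕ Fin 3 → ℤ) → CertTree ((Fin 3 × Fin 3) ⊕ Fin 3))
    (hFcc : ∃ t : CertTree (Fin 3 × Fin 3), treeOK (entryLeafOK6RBKP muRec) t rootC rootW = true)
    (hHcp : ∃ t : CertTree ((Fin 3 × Fin 3) ⊕ Fin 3), treeOK (entryLeafOKHT4UQDCRX muRec Pc Qf Tc) t rootCH rootWH = true)
    (hT : TailPenalty (24 / 5) (1 / 1000)) (hRl : CoreCoreRelief (63 / 10) (63 / 10) (24 / 5) (1 / 100) (3 / 5000))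
    (hcov : FamilyCoverG 𝓘 (24 / 5) (1 / 100) (1 / 8) τ T) (hτs : 2 * τ < s₀) (hsep : HostSep 𝓘 s₀) (hr7 : r + 2 * τ ≤ 7)
    (hH : HostFarTabS 𝓘 τ r S Xh) (hSh : ShellTail 𝓘 τ S Xe)
    (hdom : ∀ (M₀ : ℕ) (z₀ : Fin M₀ → E3) (c₀ h : Fin M₀), Xh M₀ z₀ c₀ h + Xe M₀ z₀ c₀ h ≤ X M₀ z₀ c₀ h) (hPm : PairAdm r Pm)
    (h0 : DiffEvalTabG 𝓘 τ T bondD3 (cubicTail fun s => gammaMaj (s - 2 * τ)) r (boxTabG T) (P 0))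
    (hs : ∀ i : ℕ, i < n → StageCertG 𝓘 τ T sigmaOne bondD3 (cubicTail fun s => gammaMaj (s - 2 * τ)) r hessBlk0 force0 Pm (addCol X (P i)) (P (i + 1)))
    (hcert : SlackCertG 𝓘 τ T 0 sigmaOne hessBlk0 force0 (addCol X (P n)))
    (hF : AnnularPhaseFloor (63 / 10) (24 / 5) (63 / 10) (1 / 1000)) (hP : PolyTextureFloor (63 / 10) (24 / 5) (1 / 1000))
    (hA : AnnularDefectFloor (24 / 5) (63 / 10)) (hD : DefectiveCollarFloor (24 / 5))
    (h2 : CrowdedCoreMotifPricingCapK (1 / 1000) (9 / 5) (133 / 10) (3 / 2) (effPot w₄₅ ω₄ (3 / 400)) (-(7175 / 10000) + 3 / 400)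
      (Collar (9 / 2) fun N y j => (∃ s : ℝ, 0 ≤ s ∧ s ≤ 3 / 2 ∧ NonEquilibriumCore (-(7175 / 10000)) 0 7 s (1 / 10000) N y j) ∨
        GoodAtScale (1 / 20) (3 / 2) y j))
    (h3 : DiluteDefectMotifPricingCapK (1 / 1000) (9 / 5) (133 / 10) (3 / 2) (effPot w₄₅ ω₄ (3 / 400)) (-(7175 / 10000) + 3 / 400)
      (Collar (9 / 2) fun N y j => (∃ s : ℝ, 0 ≤ s ∧ s ≤ 3 / 2 ∧ NonEquilibriumCore (-(7175 / 10000)) 0 7 s (1 / 10000) N y j) ∨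
        GoodAtScale (1 / 20) (3 / 2) y j)) :
    Summit.AtomisticToContinuum.Crystallization.Theses.FrustratedLawDichotomy.PeriodicFrustratedLawGap :=
  periodicFrustratedLawGap_of_entryTreesHTU_of_coreOff hε0 hε1 hU hDX hE Pc Qf Tc hFcc hHcp hT hRl
    (coreOff_of_envelope_shellTabs_pairTabsG P n hτ hcov hτs hsep hr7 hH hSh hdom hPm h0 hs hcert) hF hP hA hD h2 h3

/-! ## §3 ★★ The census cell with an exterior selector: `τ = 1/100`, `T = gradeTol R_g τ_in (1/100)` -/

/-- ★★ **27623 FROM THE ENTRY TREES AND THE TWO-LEVEL GRADED CELL `(R_g, τ_in)` WITH THE SHELL SPLIT AT SELECTOR `S`** —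
`hC := …ShellSplit.coreOff_record_of_gradeTol_shellTabs R_g τ_in P n …`. [folklore instantiation] -/
theorem aperiodicFrustratedLawGap_of_entryTreesU_of_gradeTol_shellTabs {𝓘 : ChartFam} (Rg τin : ℝ) {s₀ r : ℝ} {S : ShellSel} {X Xh Xe : SlackTab}
    {Pm : PairMap} {εE CE DE DX : ℝ} (P : ℕ → SlackTab) (n : ℕ)
    (hε0 : 0 < εE) (hε1 : εE ≤ 1 / 10000) (hU : PeriodicEnergyCeiling (-(7175 / 10000))) (hDX : 0 ≤ DX)
    (hE : SchurElasticPricingX (1 / 20) (1 / 8) w₄₅ ω₄ (3 / 400) (-(7175 / 10000)) (1 / 10000) CE DE DX (LocOptFails eStar εE (3 / 2) 1))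
    (Pc : ((Fin 3 × Fin 3) ⊕ Fin 3 → ℤ) → ((Fin 3 × Fin 3) ⊕ Fin 3 → ℤ) → HTCert)
    (Qf : ((Fin 3 × Fin 3) ⊕ Fin 3 → ℤ) → ((Fin 3 × Fin 3) ⊕ Fin 3 → ℤ) → (Fin 4 → ℤ))
    (Tc : ((Fin 3 × Fin 3) ⊕ Fin 3 → ℤ) → ((Fin 3 × Fin 3) ⊕ Fin 3 → ℤ) → CertTree ((Fin 3 × Fin 3) ⊕ Fin 3))
    (hFcc : ∃ t : CertTree (Fin 3 × Fin 3), treeOK (entryLeafOK6RBKP muRec) t rootC rootW = true)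
    (hHcp : ∃ t : CertTree ((Fin 3 × Fin 3) ⊕ Fin 3), treeOK (entryLeafOKHT4UQDCRX muRec Pc Qf Tc) t rootCH rootWH = true)
    (hT : TailPenalty (24 / 5) (1 / 1000)) (hRl : CoreCoreRelief (63 / 10) (63 / 10) (24 / 5) (1 / 100) (3 / 5000))
    (hcov : FamilyCoverG 𝓘 (24 / 5) (1 / 100) (1 / 8) (1 / 100) (gradeTol Rg τin (1 / 100))) (hτs : 2 * (1 / 100 : ℝ) < s₀) (hsep : HostSep 𝓘 s₀)
    (hr7 : r + 2 * (1 / 100 : ℝ) ≤ 7) (hH : HostFarTabS 𝓘 (1 / 100) r S Xh) (hSh : ShellTail 𝓘 (1 / 100) S Xe)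
    (hdom : ∀ (M₀ : ℕ) (z₀ : Fin M₀ → E3) (c₀ h : Fin M₀), Xh M₀ z₀ c₀ h + Xe M₀ z₀ c₀ h ≤ X M₀ z₀ c₀ h) (hPm : PairAdm r Pm)
    (h0 : DiffEvalTabG 𝓘 (1 / 100) (gradeTol Rg τin (1 / 100)) bondD3 (cubicTail fun s => gammaMaj (s - 2 * (1 / 100))) r
      (boxTabG (gradeTol Rg τin (1 / 100))) (P 0))
    (hs : ∀ i : ℕ, i < n → StageCertG 𝓘 (1 / 100) (gradeTol Rg τin (1 / 100)) sigmaOne bondD3 (cubicTail fun s => gammaMaj (s - 2 * (1 / 100))) r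
      hessBlk0 force0 Pm (addCol X (P i)) (P (i + 1)))
    (hcert : SlackCertG 𝓘 (1 / 100) (gradeTol Rg τin (1 / 100)) 0 sigmaOne hessBlk0 force0 (addCol X (P n)))
    (hF : AnnularPhaseFloor (63 / 10) (24 / 5) (63 / 10) (1 / 1000)) (hP : PolyTextureFloor (63 / 10) (24 / 5) (1 / 1000))
    (hA : AnnularDefectFloor (24 / 5) (63 / 10)) (hD : DefectiveCollarFloor (24 / 5))
    (h2 : CrowdedCoreMotifPricingCapK (1 / 1000) (9 / 5) (133 / 10) (3 / 2) (effPot w₄₅ ω₄ (3 / 400)) (-(7175 / 10000) + 3 / 400)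
      (Collar (9 / 2) fun N y j => (∃ s : ℝ, 0 ≤ s ∧ s ≤ 3 / 2 ∧ NonEquilibriumCore (-(7175 / 10000)) 0 7 s (1 / 10000) N y j) ∨
        GoodAtScale (1 / 20) (3 / 2) y j))
    (h3 : DiluteDefectMotifPricingCapK (1 / 1000) (9 / 5) (133 / 10) (3 / 2) (effPot w₄₅ ω₄ (3 / 400)) (-(7175 / 10000) + 3 / 400)
      (Collar (9 / 2) fun N y j => (∃ s : ℝ, 0 ≤ s ∧ s ≤ 3 / 2 ∧ NonEquilibriumCore (-(7175 / 10000)) 0 7 s (1 / 10000) N y j) ∨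
        GoodAtScale (1 / 20) (3 / 2) y j)) :
    Summit.AtomisticToContinuum.Crystallization.Theses.FrustratedLawDichotomy.AperiodicFrustratedLawGap :=
  aperiodicFrustratedLawGap_of_entryTreesHTU_of_coreOff hε0 hε1 hU hDX hE Pc Qf Tc hFcc hHcp hT hRl
    (coreOff_record_of_gradeTol_shellTabs Rg τin P n hcov hτs hsep hr7 hH hSh hdom hPm h0 hs hcert) hF hP hA hD h2 h3

/-! ## §4 Sanity: the EMPTY selector -/

/-- (R-G) With the (HFAR)/(TAILCERT) data of record the census-cell junction is fed through the EMPTY selector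
(`…ShellSplit.coreOff_record_of_gradeTol_pairTabs_via_shell`): §3 contains `…RecordJunctionGradedStage` §2. [formal bookkeeping] -/
example {𝓘 : ChartFam} (Rg τin : ℝ) {s₀ r : ℝ} {X Xh Xe : SlackTab} {Pm : PairMap} {εE CE DE DX : ℝ} (P : ℕ → SlackTab) (n : ℕ)
    (hε0 : 0 < εE) (hε1 : εE ≤ 1 / 10000) (hU : PeriodicEnergyCeiling (-(7175 / 10000))) (hDX : 0 ≤ DX)
    (hE : SchurElasticPricingX (1 / 20) (1 / 8) w₄₅ ω₄ (3 / 400) (-(7175 / 10000)) (1 / 10000) CE DE DX (LocOptFails eStar εE (3 / 2) 1))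
    (Pc : ((Fin 3 × Fin 3) ⊕ Fin 3 → ℤ) → ((Fin 3 × Fin 3) ⊕ Fin 3 → ℤ) → HTCert)
    (Qf : ((Fin 3 × Fin 3) ⊕ Fin 3 → ℤ) → ((Fin 3 × Fin 3) ⊕ Fin 3 → ℤ) → (Fin 4 → ℤ))
    (Tc : ((Fin 3 × Fin 3) ⊕ Fin 3 → ℤ) → ((Fin 3 × Fin 3) ⊕ Fin 3 → ℤ) → CertTree ((Fin 3 × Fin 3) ⊕ Fin 3))
    (hFcc : ∃ t : CertTree (Fin 3 × Fin 3), treeOK (entryLeafOK6RBKP muRec) t rootC rootW = true)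
    (hHcp : ∃ t : CertTree ((Fin 3 × Fin 3) ⊕ Fin 3), treeOK (entryLeafOKHT4UQDCRX muRec Pc Qf Tc) t rootCH rootWH = true)
    (hT : TailPenalty (24 / 5) (1 / 1000)) (hRl : CoreCoreRelief (63 / 10) (63 / 10) (24 / 5) (1 / 100) (3 / 5000))
    (hcov : FamilyCoverG 𝓘 (24 / 5) (1 / 100) (1 / 8) (1 / 100) (gradeTol Rg τin (1 / 100))) (hτs : 2 * (1 / 100 : ℝ) < s₀) (hsep : HostSep 𝓘 s₀)
    (hr7 : r + 2 * (1 / 100 : ℝ) ≤ 7) (hH : HostFarTab 𝓘 (1 / 100) r Xh) (hTl : TailCert 𝓘 (1 / 100) Xe)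
    (hdom : ∀ (M₀ : ℕ) (z₀ : Fin M₀ → E3) (c₀ h : Fin M₀), Xh M₀ z₀ c₀ h + Xe M₀ z₀ c₀ h ≤ X M₀ z₀ c₀ h) (hPm : PairAdm r Pm)
    (h0 : DiffEvalTabG 𝓘 (1 / 100) (gradeTol Rg τin (1 / 100)) bondD3 (cubicTail fun s => gammaMaj (s - 2 * (1 / 100))) r
      (boxTabG (gradeTol Rg τin (1 / 100))) (P 0))
    (hs : ∀ i : ℕ, i < n → StageCertG 𝓘 (1 / 100) (gradeTol Rg τin (1 / 100)) sigmaOne bondD3 (cubicTail fun s => gammaMaj (s - 2 * (1 / 100))) r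
      hessBlk0 force0 Pm (addCol X (P i)) (P (i + 1)))
    (hcert : SlackCertG 𝓘 (1 / 100) (gradeTol Rg τin (1 / 100)) 0 sigmaOne hessBlk0 force0 (addCol X (P n)))
    (hF : AnnularPhaseFloor (63 / 10) (24 / 5) (63 / 10) (1 / 1000)) (hP : PolyTextureFloor (63 / 10) (24 / 5) (1 / 1000))
    (hA : AnnularDefectFloor (24 / 5) (63 / 10)) (hD : DefectiveCollarFloor (24 / 5))
    (h2 : CrowdedCoreMotifPricingCapK (1 / 1000) (9 / 5) (133 / 10) (3 / 2) (effPot w₄₅ ω₄ (3 / 400)) (-(7175 / 10000) + 3 / 400)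
      (Collar (9 / 2) fun N y j => (∃ s : ℝ, 0 ≤ s ∧ s ≤ 3 / 2 ∧ NonEquilibriumCore (-(7175 / 10000)) 0 7 s (1 / 10000) N y j) ∨
        GoodAtScale (1 / 20) (3 / 2) y j))
    (h3 : DiluteDefectMotifPricingCapK (1 / 1000) (9 / 5) (133 / 10) (3 / 2) (effPot w₄₅ ω₄ (3 / 400)) (-(7175 / 10000) + 3 / 400)
      (Collar (9 / 2) fun N y j => (∃ s : ℝ, 0 ≤ s ∧ s ≤ 3 / 2 ∧ NonEquilibriumCore (-(7175 / 10000)) 0 7 s (1 / 10000) N y j) ∨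
        GoodAtScale (1 / 20) (3 / 2) y j)) :
    Summit.AtomisticToContinuum.Crystallization.Theses.FrustratedLawDichotomy.AperiodicFrustratedLawGap :=
  aperiodicFrustratedLawGap_of_entryTreesHTU_of_coreOff hε0 hε1 hU hDX hE Pc Qf Tc hFcc hHcp hT hRl
    (coreOff_record_of_gradeTol_pairTabs_via_shell Rg τin P n hcov hτs hsep hr7 hH hTl hdom hPm h0 hs hcert) hF hP hA hD h2 h3

end Summit.AtomisticToContinuum.Crystallization.Theorems.FrustratedLawDichotomyAperiodicGapRecordJunctionShell

end
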